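import Summits.ResolutionOfSingularities.ResolutionOfSingularities.Theorems.FrobeniusLadderFRationalResolutionFixedPointKatoIdeal
import Summits.ResolutionOfSingularities.ResolutionOfSingularities.Theorems.FrobeniusLadderFRationalResolutionFixedPointDimension
import Summits.ResolutionOfSingularities.ResolutionOfSingularities.Theorems.FrobeniusLadderFRationalResolutionFixedPointGenerators
import Literature.AlgebraicGeometry.Resolution.LogRegularCompleteStructure
import Literature.AlgebraicGeometry.Resolution.AdicCompletionRegular
import Literature.RingTheory.CompleteLocalRings.CoefficientField
import Mathlib.RingTheory.AdicCompletion.LocalRing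
import Mathlib.Algebra.Group.Submonoid.Finsupp
import Mathlib.Data.Finsupp.Weight
import Mathlib.LinearAlgebra.Dimension.Constructions
import Mathlib.LinearAlgebra.StdBasis
import HarnessLib

/-!
# Crux `FrobeniusLadder.FRationalResolution` (stmt-ResolutionOfSingularities-15317), line `redirect`,
# stub `stub_diagonalizableQuotientResolution` — **the COMPLETE LOCAL RING of the quotient chart at a FIXED point is a
# monoid power-series ring**: `((S₀)_𝔮)^ ≅ κ⟦P_a⟧`, `P_a ⊆ ℕⁿ` the weight kernel of the homogeneous parameters
# (item (E) of MEMO-15317-leafhand2-g19 §2: d = 0 Kato chart data on the completion, from the graded regular algebra)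

`S` a REGULAR algebra of finite type over a field `k` graded by a torsion abelian group `A` (an action of `D(A)`),
`S₀ = 𝒮 0`, `𝔔` a `D(A)`-FIXED prime (`𝔔 ⊇ S_a`, `a ≠ 0`), `𝔮 = 𝔔 ∩ S₀`. The fixed-point bricks (`…FixedPointGenerators`:
homogeneous `x₁,…,x_n ∈ 𝔔`, `n = dim S_𝔔`, of degrees `aᵢ`, generating `𝔔S_𝔔`; `…FixedPointKatoIdeal`: `𝔮(S₀)_𝔮` is generated
by the degree-`0` monomials in `x`; `…FixedPointDimension`: `dim (S₀)_𝔮 = n`) become d = 0 KATO CHART DATA in the `ℕ`-exponent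
language of `…HfinOfChartData` / `Literature…LogRegularCompleteStructure`, and Kato (3.2)(1) runs with a Cohen coefficient field:

* `mker_weight_fg`, `rank_mker_weight` — the weight kernel `P_a = {m ∈ ℕⁿ : Σ mᵢ • aᵢ = 0}` of torsion degrees is finitely
  generated (by its elements with coordinates `≤ ord(aᵢ)`) of rank `n` (it contains `ord(aᵢ) • eᵢ`).
* ★ `exists_ringEquiv_monoidPowerSeries_adicCompletion_of_chartData` — GENERIC: an equicharacteristic Noetherian local `R` with
  d = 0 chart data (`χ` multiplicative on `P`, `χ(P ∖ 0) ⊆ 𝔪` generating `𝔪`, `dim R = rank P`) has `κ(R)⟦P⟧ ≃+* R^`, `x^p ↦ χ(p)`.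
* ★★ `exists_chartData_of_fixed` — at a fixed prime, for ANY localization `Rq` of `S₀` at `𝔮` (generic `IsLocalization.AtPrime`):
  the weight kernel `P_a`, the monomial chart `χ(m) = x^m ∈ S₀`, `χ(P ∖ 0) ⊆ 𝔪_{Rq}` generating it, `dim Rq = rank P_a = n`.
* ★★★ `exists_ringEquiv_monoidPowerSeries_adicCompletion_of_fixed` — **`κ(𝔮)⟦P_a⟧ ≃+* (Rq)^`, `x^m ↦ x^m`**: the formal
  LINEARISATION of a diagonalizable quotient singularity at a fixed point (every characteristic, wild `p ∣ |A|` included).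

This is input (E) of `…MonomialAlgebraCompletion.hloc_of_ringEquiv_monoidPowerSeries` / `…HfinOfChartDataField` on the chart
side (transport to the Galois route's `Ê`: `…CompletionOfFlatUnramifiedAtPrime.exists_ringEquiv_adicCompletion_localRingHom`).
Honest label: helper theorems toward ONE leaf stub (no stub, crux or summit closed). No definitions, no named facts, no sorry.
[cite: Kato1994, Thm. (3.2)] [cite: Matsumura1987, Thm. 28.3 (ii); Thm. 8.11; Thm. 15.1] [folklore; cite: SGA3, Exp. VIII §4–5]
-/

noncomputable section

-- single-problem summit: the doubled namespace component is forced
set_option linter.dupNamespace false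

open IsLocalRing
open Literature.RingTheory.MvPowerSeries Literature.RingTheory.MvPowerSeries.monoidPowerSeries
open Literature.RingTheory.CompleteLocalRings
open Literature.AlgebraicGeometry.Resolution
open Literature.AlgebraicGeometry.Resolution.DiagonalizableQuotient

namespace Summit.ResolutionOfSingularities.ResolutionOfSingularities.Theorems.FRationalResolution.FixedPointCompletionChart

universe u v w

/-! ## The weight kernel of torsion degrees: finitely generated of full rank -/

section WeightKernel

variable {n : ℕ} {A : Type w} [AddCommGroup A] (a : Fin n → A)

/-- `weight a m = Σᵢ mᵢ • aᵢ`. [folklore] -/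
theorem weight_eq_sum (m : Fin n →₀ ℕ) : Finsupp.weight a m = ∑ i, m i • a i := by
  rw [Finsupp.weight_apply, Finsupp.sum_fintype]
  exact fun i => zero_smul ℕ (a i)

/-- `ord(aᵢ) • eᵢ` lies in the weight kernel. [folklore] -/
theorem weight_single_addOrderOf (i : Fin n) :
    Finsupp.weight a (Finsupp.single i (addOrderOf (a i))) = 0 := by
  rw [Finsupp.weight_single, addOrderOf_nsmul_eq_zero]

/-- **The weight kernel of torsion degrees is a finitely generated monoid**: `P_a = {m ∈ ℕⁿ : Σ mᵢ • aᵢ = 0}` is generated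
by its elements with coordinates `≤ ord(aᵢ)` (subtract `ord(aᵢ) • eᵢ` while some coordinate exceeds `ord(aᵢ)`).
[folklore; cite: BrunsHerzog1993, §6.1 (Gordan's lemma)] -/
theorem mker_weight_fg (ha : ∀ i, IsOfFinAddOrder (a i)) :
    (AddMonoidHom.mker (Finsupp.weight a : (Fin n →₀ ℕ) →+ A)).FG := by
  classical
  have hNpos : ∀ i, 0 < addOrderOf (a i) := fun i => (ha i).addOrderOf_pos
  -- the finite generating set: kernel elements with all coordinates `≤ ord(aᵢ)`
  have hBfin : ({m : Fin n →₀ ℕ | Finsupp.weight a m = 0 ∧ ∀ i, m i ≤ addOrderOf (a i)}).Finite := by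
    refine (Finsupp.finite_of_degree_le (σ := Fin n) (∑ i, addOrderOf (a i))).subset ?_
    rintro m ⟨-, hm⟩
    simp only [Set.mem_setOf_eq]
    rw [Finsupp.degree_eq_sum]
    exact Finset.sum_le_sum fun i _ => hm i
  refine ⟨hBfin.toFinset, ?_⟩
  rw [Set.Finite.coe_toFinset]
  apply le_antisymm
  · rw [AddSubmonoid.closure_le]
    rintro m ⟨hm, -⟩
    exact hm
  · suffices h : ∀ d : ℕ, ∀ m : Fin n →₀ ℕ, m.degree ≤ d → Finsupp.weight a m = 0 →
        m ∈ AddSubmonoid.closure {m : Fin n →₀ ℕ | Finsupp.weight a m = 0 ∧ ∀ i, m i ≤ addOrderOf (a i)} by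
      intro m hm
      exact h _ m le_rfl hm
    intro d
    induction d with
    | zero =>
      intro m hm _
      rw [(Finsupp.degree_eq_zero_iff m).mp (Nat.le_zero.mp hm)]
      exact zero_mem _
    | succ d ih =>
      intro m hm hw
      by_cases hsmall : ∀ i, m i ≤ addOrderOf (a i)
      · exact AddSubmonoid.subset_closure ⟨hw, hsmall⟩
      · push Not at hsmall
        obtain ⟨i, hi⟩ := hsmall
        have hle : Finsupp.single i (addOrderOf (a i)) ≤ m := Finsupp.single_le_iff.mpr hi.le
        obtain ⟨m', rfl⟩ : ∃ m', m = m' + Finsupp.single i (addOrderOf (a i)) :=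
          ⟨m - Finsupp.single i (addOrderOf (a i)), (tsub_add_cancel_of_le hle).symm⟩
        have hw' : Finsupp.weight a m' = 0 := by
          rwa [map_add, weight_single_addOrderOf, add_zero] at hw
        have hdeg' : m'.degree ≤ d := by
          rw [map_add, Finsupp.degree_single] at hm
          have := hNpos i
          omega
        refine add_mem (ih m' hdeg' hw') (AddSubmonoid.subset_closure ⟨weight_single_addOrderOf a i, fun j => ?_⟩)
        rw [Finsupp.single_apply]
        split_ifs with hij
        exacts [hij ▸ le_rfl, Nat.zero_le _]

/-- **The weight kernel of torsion degrees has rank `n`**: its `ℚ`-span contains `ord(aᵢ) • eᵢ`, hence every `eᵢ`.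
[folklore; cite: Kato1994, (5.4)–(5.5)] -/
theorem rank_mker_weight (ha : ∀ i, IsOfFinAddOrder (a i)) :
    rank (AddMonoidHom.mker (Finsupp.weight a : (Fin n →₀ ℕ) →+ A)) = n := by
  classical
  have hW : Submodule.span ℚ (toRatVec ''
      ((AddMonoidHom.mker (Finsupp.weight a : (Fin n →₀ ℕ) →+ A) : AddSubmonoid (Fin n →₀ ℕ)) :
        Set (Fin n →₀ ℕ))) = ⊤ := by
    apply eq_top_iff.mpr
    rw [← (Pi.basisFun ℚ (Fin n)).span_eq, Submodule.span_le]
    rintro _ ⟨i, rfl⟩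
    rw [Pi.basisFun_apply]
    have hmem : toRatVec (Finsupp.single i (addOrderOf (a i))) ∈ Submodule.span ℚ (toRatVec ''
        ((AddMonoidHom.mker (Finsupp.weight a : (Fin n →₀ ℕ) →+ A) : AddSubmonoid (Fin n →₀ ℕ)) :
          Set (Fin n →₀ ℕ))) :=
      Submodule.subset_span ⟨_, (AddMonoidHom.mem_mker).mpr (weight_single_addOrderOf a i), rfl⟩
    have hN : (addOrderOf (a i) : ℚ) ≠ 0 := Nat.cast_ne_zero.mpr (ha i).addOrderOf_pos.ne'
    have hvec : toRatVec (Finsupp.single i (addOrderOf (a i))) = Pi.single i (addOrderOf (a i) : ℚ) := by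
      ext j
      rw [toRatVec_apply, Finsupp.single_apply, Pi.single_apply]
      by_cases h : j = i
      · subst h
        simp
      · rw [if_neg (Ne.symm h), if_neg h, Nat.cast_zero]
    have heq : (Pi.single i 1 : Fin n → ℚ) =
        (addOrderOf (a i) : ℚ)⁻¹ • toRatVec (Finsupp.single i (addOrderOf (a i))) := by
      rw [hvec, ← Pi.single_smul', smul_eq_mul, inv_mul_cancel₀ hN]
    rw [heq]
    exact Submodule.smul_mem _ _ hmem
  unfold rank
  rw [hW, finrank_top, Module.finrank_fin_fun]

end WeightKernel

/-! ## Kato (3.2)(1) for the completion of an equicharacteristic local ring with d = 0 chart data -/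

/-- A ring map out of a field into a nontrivial ring is a local homomorphism. [folklore] -/
theorem isLocalHom_of_field' {κ E : Type*} [Field κ] [CommRing E] [Nontrivial E] (j : κ →+* E) :
    IsLocalHom j := by
  refine ⟨fun x hx => ?_⟩
  by_cases h : x = 0
  · subst h
    rw [map_zero] at hx
    exact (not_isUnit_zero hx).elim
  · exact isUnit_iff_ne_zero.mpr h

/-- ★ **Kato (3.2)(1) for `R^`, equicharacteristic generic form.** `R` a Noetherian local ring containing a field, with
d = 0 chart data by a finitely generated `P ⊆ ℕⁿ`: a map `χ : ℕⁿ → R`, multiplicative on `P` with `χ 0 = 1`,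
`χ(P ∖ 0) ⊆ 𝔪_R` generating `𝔪_R`, and `dim R = rank P`. Then `κ(R)⟦P⟧ ≃+* R^` with `x^p ↦ χ(p)`, `κ(R)` the residue
field of `R` (a coefficient field of `R^` exists by Cohen's theorem, and `κ(R) = κ(R^)`). [cite: Kato1994, Thm. (3.2)]
[cite: Matsumura1987, Thm. 28.3 (ii); Thm. 8.11; Thm. 15.1] -/
theorem exists_ringEquiv_monoidPowerSeries_adicCompletion_of_chartData {R : Type u} [CommRing R] [IsLocalRing R]
    [IsNoetherianRing R] {K : Type v} [Field K] (i : K →+* R)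
    {n : ℕ} (P : AddSubmonoid (Fin n →₀ ℕ)) (hPfg : P.FG)
    (χ : (Fin n →₀ ℕ) → R) (hχ0 : χ 0 = 1) (hχadd : ∀ a ∈ P, ∀ b ∈ P, χ (a + b) = χ a * χ b)
    (hχm : ∀ p ∈ P, p ≠ 0 → χ p ∈ maximalIdeal R)
    (hgen : maximalIdeal R ≤ Ideal.span (χ '' {p | p ∈ P ∧ p ≠ 0}))
    (hdim : ringKrullDim R = rank P) :
    ∃ e : ↥(monoidPowerSeries (ResidueField R) P) ≃+* AdicCompletion (maximalIdeal R) R,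
      ∀ (p : Fin n →₀ ℕ) (hp : p ∈ P),
        e ⟨MvPowerSeries.monomial p 1, monomial_mem hp 1⟩ = algebraMap R _ (χ p) := by
  classical
  haveI : IsNoetherianRing (AdicCompletion (maximalIdeal R) R) := isNoetherianRing_adicCompletion_maximalIdeal R
  -- a coefficient field (Cohen): `E` contains the field `K`
  let j₀ : K →+* AdicCompletion (maximalIdeal R) R := (algebraMap R (AdicCompletion (maximalIdeal R) R)).comp i
  have hj₀ : Function.Injective j₀ := j₀.injective
  have hk₀ : IsField j₀.range :=
    MulEquiv.isField (Field.toIsField K)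
      (RingEquiv.ofBijective j₀.rangeRestrict
        ⟨fun x y h => hj₀ (congrArg Subtype.val h), j₀.rangeRestrict_surjective⟩).symm.toMulEquiv
  obtain ⟨σ, hσ⟩ := exists_ringHom_comp_residue_eq_id_of_subring (AdicCompletion (maximalIdeal R) R) j₀.range hk₀
  -- the coefficient field seen from the residue field of `R` (`κ(R) ≅ κ(R^)`)
  let σ' : ResidueField R →+* AdicCompletion (maximalIdeal R) R :=
    σ.comp (ResidueField.map (algebraMap R (AdicCompletion (maximalIdeal R) R)))
  haveI : IsLocalHom σ' := isLocalHom_of_field' σ'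
  have hres : ∀ x : AdicCompletion (maximalIdeal R) R, ∃ l : ResidueField R,
      x - σ' l ∈ maximalIdeal (AdicCompletion (maximalIdeal R) R) := fun x => by
    obtain ⟨l, hl⟩ := (AdicCompletion.residueField_map_bijective R).2 (residue _ x)
    exact ⟨l, by rw [← residue_eq_zero_iff, map_sub, RingHom.comp_apply, hσ, hl, sub_self]⟩
  -- the chart of `R^`
  let φ : (Fin n →₀ ℕ) → AdicCompletion (maximalIdeal R) R := fun p => algebraMap R _ (χ p)
  have hφ0 : φ 0 = 1 := by simp only [φ, hχ0, map_one]
  have hφadd : ∀ a ∈ P, ∀ b ∈ P, φ (a + b) = φ a * φ b := by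
    intro a ha b hb
    simp only [φ, hχadd a ha b hb, map_mul]
  have hmaxE : maximalIdeal (AdicCompletion (maximalIdeal R) R) =
      (maximalIdeal R).map (algebraMap R (AdicCompletion (maximalIdeal R) R)) :=
    AdicCompletion.maximalIdeal_eq_map
  have hφm : ∀ p ∈ P, p ≠ 0 → φ p ∈ maximalIdeal (AdicCompletion (maximalIdeal R) R) := by
    intro p hp hp0
    rw [hmaxE]
    exact Ideal.mem_map_of_mem _ (hχm p hp hp0)
  have hgenE : maximalIdeal (AdicCompletion (maximalIdeal R) R) ≤ Ideal.span (φ '' {p | p ∈ P ∧ p ≠ 0}) := by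
    rw [hmaxE]
    refine (Ideal.map_mono hgen).trans ?_
    rw [Ideal.map_span, ← Set.image_comp]
    rfl
  have hdimE : ringKrullDim (AdicCompletion (maximalIdeal R) R) = rank P := by
    rw [ringKrullDim_adicCompletion R]
    exact hdim
  -- Kato (3.2)(1): the lift is surjective, and injective by dimension
  haveI : IsAdicComplete (maximalIdeal (ResidueField R)) (ResidueField R) := by
    rw [IsLocalRing.maximalIdeal_eq_bot]
    infer_instance
  obtain ⟨ψ, hψsurj, hψφ, -⟩ :=
    LogRegularCompleteStructure.exists_lift_surjective (A := AdicCompletion (maximalIdeal R) R)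
      (Λ := ResidueField R) σ' hres hPfg φ hφ0 hφadd hφm hgenE
  have hker := LogRegularCompleteStructure.ker_eq_bot_of_field
    (A := AdicCompletion (maximalIdeal R) R) hPfg ψ hψsurj hdimE
  have hinj : Function.Injective ψ := (RingHom.injective_iff_ker_eq_bot ψ).mpr hker
  exact ⟨RingEquiv.ofBijective ψ ⟨hinj, hψsurj⟩, fun p hp => hψφ p hp⟩

/-! ## d = 0 chart data at a fixed point of a regular graded algebra -/

section Fixed

variable {k : Type u} [Field k] {A : Type w} [DecidableEq A] [AddCommGroup A] {S : Type u}
  [CommRing S] [Algebra k S] (𝒮 : A → Submodule k S) [GradedAlgebra 𝒮]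

/-- The monomial `x^m` in homogeneous `xᵢ ∈ S_{aᵢ}` is homogeneous of degree `weight a m = Σ mᵢ • aᵢ`. [folklore] -/
theorem prod_pow_mem_weight {n : ℕ} (x : Fin n → S) (a : Fin n → A) (hx : ∀ i, x i ∈ 𝒮 (a i))
    (m : Fin n →₀ ℕ) : ∏ i, x i ^ m i ∈ 𝒮 (Finsupp.weight a m) := by
  rw [weight_eq_sum]
  exact SetLike.prod_pow_mem_graded 𝒮 a x (F := Finset.univ) (fun i => m i) fun i _ => hx i

/-- ★★ **d = 0 Kato chart data at a fixed point.** `S` regular of finite type over a field, graded by a torsion group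
`A`; `𝔔` a prime containing every `S_a`, `a ≠ 0`; `Rq` any localization of `S₀` at `𝔮 = 𝔔 ∩ S₀`. There are homogeneous
`x₁,…,x_n ∈ 𝔔` of degrees `aᵢ` with `n = dim S_𝔔`, the weight kernel `P = {m : Σ mᵢ • aᵢ = 0}` (finitely generated,
of rank `n`) and the monomial chart `χ(m) = x^m ∈ S₀` (`m ∈ P`; `χ 0 = 1`, multiplicative on `P`) such that
`χ(P ∖ 0) ⊆ 𝔪_{Rq}` generates `𝔪_{Rq}` and `dim Rq = rank P`. [cite: Kato1994, Def. (2.1), Thm. (3.2)]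
[folklore; cite: SGA3, Exp. VIII §4–5] -/
theorem exists_chartData_of_fixed [IsRegularRing S] [Algebra.FiniteType k S]
    (hA : AddMonoid.IsTorsion A) (𝔔 : Ideal S) [𝔔.IsPrime]
    (hfix : ∀ a : A, a ≠ 0 → ∀ s ∈ 𝒮 a, s ∈ 𝔔)
    (Rq : Type u) [CommRing Rq] [Algebra (𝒮 0) Rq]
    [IsLocalization.AtPrime Rq (𝔔.comap (algebraMap (𝒮 0) S))] [IsLocalRing Rq] :
    ∃ (n : ℕ) (x : Fin n → S) (a : Fin n → A) (P : AddSubmonoid (Fin n →₀ ℕ)) (χ : (Fin n →₀ ℕ) → 𝒮 0),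
      (∀ i, x i ∈ 𝔔 ∧ x i ∈ 𝒮 (a i)) ∧ (n : WithBot ℕ∞) = ringKrullDim (Localization.AtPrime 𝔔) ∧
      (∀ m, m ∈ P ↔ Finsupp.weight a m = 0) ∧ P.FG ∧ rank P = n ∧
      (∀ m ∈ P, ((χ m : 𝒮 0) : S) = ∏ i, x i ^ m i) ∧ χ 0 = 1 ∧
      (∀ m ∈ P, ∀ m' ∈ P, χ (m + m') = χ m * χ m') ∧
      (∀ m ∈ P, m ≠ 0 → algebraMap (𝒮 0) Rq (χ m) ∈ maximalIdeal Rq) ∧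
      maximalIdeal Rq ≤ Ideal.span ((fun m => algebraMap (𝒮 0) Rq (χ m)) '' {m | m ∈ P ∧ m ≠ 0}) ∧
      ringKrullDim Rq = rank P := by
  classical
  -- brick 1: a homogeneous regular system of parameters of `S_𝔔`
  obtain ⟨t, hthom, htspan, htcard⟩ :=
    FixedPointGenerators.exists_homogeneous_regularParameters_of_fixed 𝒮 𝔔 hfix
  set n := t.card with hn
  let x : Fin n → S := fun i => (t.equivFin.symm i : S)
  choose a ha using fun i : Fin n => (hthom _ (t.equivFin.symm i).2).2
  have hx𝔔 : ∀ i, x i ∈ 𝔔 := fun i => (hthom _ (t.equivFin.symm i).2).1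
  have htors : ∀ i, IsOfFinAddOrder (a i) := fun i => hA (a i)
  -- the weight kernel and the monomial chart
  set P : AddSubmonoid (Fin n →₀ ℕ) := AddMonoidHom.mker (Finsupp.weight a : (Fin n →₀ ℕ) →+ A) with hP
  have hmemP : ∀ m, m ∈ P ↔ Finsupp.weight a m = 0 := fun m => AddMonoidHom.mem_mker
  have hmem0 : ∀ m ∈ P, ∏ i, x i ^ m i ∈ 𝒮 0 := fun m hm => by
    have h := prod_pow_mem_weight 𝒮 x a ha m
    rwa [(hmemP m).mp hm] at h
  let χ : (Fin n →₀ ℕ) → 𝒮 0 := fun m => if hm : m ∈ P then ⟨∏ i, x i ^ m i, hmem0 m hm⟩ else 1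
  have hχ : ∀ m (hm : m ∈ P), χ m = ⟨∏ i, x i ^ m i, hmem0 m hm⟩ := fun m hm => dif_pos hm
  set 𝔮 : Ideal (𝒮 0) := 𝔔.comap (algebraMap (𝒮 0) S) with h𝔮
  have hrange : (↑t : Set S) = Set.range x := by
    ext s
    constructor
    · intro hs
      exact ⟨t.equivFin ⟨s, hs⟩, by simp [x]⟩
    · rintro ⟨i, rfl⟩
      exact (t.equivFin.symm i).2
  have hχ𝔮 : ∀ m ∈ P, m ≠ 0 → χ m ∈ 𝔮 := by
    intro m hm hm0
    obtain ⟨i, hi⟩ : ∃ i, m i ≠ 0 := by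
      by_contra h
      push Not at h
      exact hm0 (Finsupp.ext h)
    change ((χ m : 𝒮 0) : S) ∈ 𝔔
    rw [hχ m hm]
    change ∏ i, x i ^ m i ∈ 𝔔
    rw [← Finset.mul_prod_erase Finset.univ _ (Finset.mem_univ i)]
    exact Ideal.mul_mem_right _ _ (Ideal.pow_mem_of_mem 𝔔 (hx𝔔 i) _ (Nat.pos_of_ne_zero hi))
  refine ⟨n, x, a, P, χ, fun i => ⟨hx𝔔 i, ha i⟩, htcard, hmemP, mker_weight_fg a htors,
    rank_mker_weight a htors, fun m hm => by rw [hχ m hm], ?_, ?_, ?_, ?_, ?_⟩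
  · -- `χ 0 = 1`
    rw [hχ 0 (zero_mem P)]
    exact Subtype.ext (by simp)
  · -- multiplicativity on `P`
    intro m hm m' hm'
    rw [hχ m hm, hχ m' hm', hχ (m + m') (add_mem hm hm')]
    refine Subtype.ext ?_
    change ∏ i, x i ^ (m + m') i = (∏ i, x i ^ m i) * ∏ i, x i ^ m' i
    rw [← Finset.prod_mul_distrib]
    exact Finset.prod_congr rfl fun i _ => by rw [Finsupp.add_apply, pow_add]
  · -- `χ(P ∖ 0) ⊆ 𝔪_{Rq}`
    intro m hm hm0
    have h := Ideal.mem_map_of_mem (algebraMap (𝒮 0) Rq) (hχ𝔮 m hm hm0)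
    rwa [IsLocalization.AtPrime.map_eq_maximalIdeal 𝔮 Rq] at h
  · -- `𝔪_{Rq}` is generated by `χ(P ∖ 0)` (brick `…FixedPointKatoIdeal`)
    rw [FixedPointKatoIdeal.maximalIdeal_eq_span_monomials_of_fixed 𝒮 hA 𝔔 hfix t
      (fun s hs => (hthom s hs).2) htspan Rq]
    refine Ideal.span_le.mpr ?_
    rintro _ ⟨g, ⟨hg𝔔, hgcl⟩, rfl⟩
    rw [hrange] at hgcl
    obtain ⟨e, he⟩ := Submonoid.mem_closure_range_iff_of_fintype.mp hgcl
    let m : Fin n →₀ ℕ := Finsupp.equivFunOnFinite.symm e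
    have hprod : ∏ i, x i ^ m i = (g : S) := by
      rw [he]
      exact Finset.prod_congr rfl fun i _ => rfl
    by_cases hdeg : Finsupp.weight a m = 0
    · have hmP : m ∈ P := (hmemP m).mpr hdeg
      have hχm : χ m = g := by
        rw [hχ m hmP]
        exact Subtype.ext hprod
      have hm0 : m ≠ 0 := by
        rintro hm
        apply (inferInstance : 𝔔.IsPrime).ne_top
        rw [Ideal.eq_top_iff_one]
        have h1 : (g : S) = 1 := by
          rw [← hprod, hm]
          simp
        rwa [h1] at hg𝔔
      exact Ideal.subset_span ⟨m, ⟨hmP, hm0⟩, by simp only [hχm]⟩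
    · -- a monomial of non-zero degree lying in `S₀` vanishes
      have hgd : (g : S) ∈ 𝒮 (Finsupp.weight a m) := by
        rw [← hprod]
        exact prod_pow_mem_weight 𝒮 x a ha m
      have hg0 : (g : S) = 0 := by
        have h1 := DirectSum.decompose_of_mem_ne 𝒮 hgd hdeg
        rwa [DirectSum.decompose_of_mem_same 𝒮 g.2] at h1
      have hg0' : g = 0 := Subtype.ext hg0
      rw [hg0', map_zero]
      exact Ideal.zero_mem _
  · -- `dim Rq = dim S_𝔔 = n = rank P` (brick `…FixedPointDimension`)
    have hle : 𝔮.primeCompl ≤ 𝔔.primeCompl.comap (algebraMap (𝒮 0) S) := fun r hr => hr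
    letI : Algebra Rq (Localization.AtPrime 𝔔) :=
      (IsLocalization.map (Localization.AtPrime 𝔔) (algebraMap (𝒮 0) S) hle : Rq →+* _).toAlgebra
    haveI : IsScalarTower (𝒮 0) Rq (Localization.AtPrime 𝔔) :=
      IsScalarTower.of_algebraMap_eq fun r => by
        rw [RingHom.algebraMap_toAlgebra, IsLocalization.map_eq,
          IsScalarTower.algebraMap_apply (𝒮 0) S (Localization.AtPrime 𝔔)]
    rw [FixedPointDimension.ringKrullDim_atPrime_eq_of_fixed 𝒮 hA 𝔔 hfix Rq (Localization.AtPrime 𝔔),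
      ← htcard, rank_mker_weight a htors]

/-- ★★★ **FORMAL LINEARISATION AT A FIXED POINT: `κ⟦P_a⟧ ≅ ((S₀)_𝔮)^`.** `S` regular of finite type over a field,
graded by a torsion group `A`; `𝔔` a `D(A)`-fixed prime, `𝔮 = 𝔔 ∩ S₀`, `Rq` any localization of `S₀` at `𝔮`. With the
homogeneous parameters `x₁,…,x_n` (`n = dim S_𝔔 = dim Rq`) of degrees `aᵢ` and the weight kernel
`P = {m ∈ ℕⁿ : Σ mᵢ • aᵢ = 0}` (finitely generated, rank `n`), there is a ring isomorphism
`κ(𝔮)⟦P⟧ ≃+* Rq^` sending `x^m ↦ x^m` (`κ(𝔮)` the residue field of `Rq`).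
[cite: Kato1994, Thm. (3.2)] [cite: Matsumura1987, Thm. 28.3 (ii)] [folklore; cite: SGA3, Exp. VIII §4–5] -/
theorem exists_ringEquiv_monoidPowerSeries_adicCompletion_of_fixed [IsRegularRing S] [Algebra.FiniteType k S]
    (hA : AddMonoid.IsTorsion A) (𝔔 : Ideal S) [𝔔.IsPrime]
    (hfix : ∀ a : A, a ≠ 0 → ∀ s ∈ 𝒮 a, s ∈ 𝔔)
    (Rq : Type u) [CommRing Rq] [Algebra (𝒮 0) Rq]
    [IsLocalization.AtPrime Rq (𝔔.comap (algebraMap (𝒮 0) S))] [IsLocalRing Rq] :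
    ∃ (n : ℕ) (x : Fin n → S) (a : Fin n → A) (P : AddSubmonoid (Fin n →₀ ℕ)) (χ : (Fin n →₀ ℕ) → 𝒮 0),
      (∀ i, x i ∈ 𝔔 ∧ x i ∈ 𝒮 (a i)) ∧ (n : WithBot ℕ∞) = ringKrullDim (Localization.AtPrime 𝔔) ∧
      ringKrullDim Rq = n ∧ (∀ m, m ∈ P ↔ Finsupp.weight a m = 0) ∧ P.FG ∧ rank P = n ∧
      (∀ m ∈ P, ((χ m : 𝒮 0) : S) = ∏ i, x i ^ m i) ∧
      ∃ e : ↥(monoidPowerSeries (ResidueField Rq) P) ≃+* AdicCompletion (maximalIdeal Rq) Rq,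
        ∀ (m : Fin n →₀ ℕ) (hm : m ∈ P), e ⟨MvPowerSeries.monomial m 1, monomial_mem hm 1⟩ =
          algebraMap Rq (AdicCompletion (maximalIdeal Rq) Rq) (algebraMap (𝒮 0) Rq (χ m)) := by
  obtain ⟨n, x, a, P, χ, hxa, hn, hmemP, hPfg, hrank, hχ, hχ0, hχadd, hχm, hgen, hdim⟩ :=
    exists_chartData_of_fixed 𝒮 hA 𝔔 hfix Rq
  haveI : IsNoetherianRing (𝒮 0) := isNoetherianRing_gradeZero 𝒮 hA
  haveI : IsNoetherianRing Rq :=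
    IsLocalization.isNoetherianRing (𝔔.comap (algebraMap (𝒮 0) S)).primeCompl Rq inferInstance
  obtain ⟨e, he⟩ := exists_ringEquiv_monoidPowerSeries_adicCompletion_of_chartData
    ((algebraMap (𝒮 0) Rq).comp (algebraMap k (𝒮 0))) P hPfg (fun m => algebraMap (𝒮 0) Rq (χ m))
    (by rw [hχ0, map_one]) (fun m hm m' hm' => by rw [hχadd m hm m' hm', map_mul]) hχm hgen hdim
  exact ⟨n, x, a, P, χ, hxa, hn, by rw [hdim, hrank], hmemP, hPfg, hrank, hχ, e, he⟩

end Fixed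

end Summit.ResolutionOfSingularities.ResolutionOfSingularities.Theorems.FRationalResolution.FixedPointCompletionChart

end
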